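import Summits.RiemannHypothesis.RiemannHypothesis.Theorems.TiltedLandingLaw421R3Lens1Coverage2

/-! # Lens-1 COVERAGE THEOREM (file A3 of 4: §9–§10 partial) — see file A1 for full header -/

namespace RhW08.Lens1Coverage

set_option linter.dupNamespace false

open Complex Set
open scoped ComplexConjugate
open Literature.Analysis.Complex
open Summit.RiemannHypothesis.RiemannHypothesis.Theorems.Splittings.JensenWindow
open RhIdea6.G17.W07C7 RhIdea6.G17.W07C7.Rev6 RhIdea6.G18.W07C8.Law421BirthS RhIdea6.G19.W07C11.Seam
open RhIdea6.G20.W07C12.Frac RhIdea6.G20.W07C12.StColP RhW07.C12.FieldSplit RhIdea6.G21.W07C13.TentMax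
open RhW07.C14.TwoSided RhW07.C14.Classes RhW07.C14.Lineage RhW07.C14.Booking
open RhW07.C13.Heredity RhIdea6.G22.W07C15pre.Injection RhW07.E3.Cell RhW07.E3.Lit
open RhW08.Round1 RhW08.StSwap RhW08.Round2 RhW08.QuadW RhW08.SealSwapQ RhW08.SealSwap RhW08.SuccB RhW08.SuccSplit
open RhW08.SuccTheft RhW08.Column RhW08.Hurwitz RhW08.ClusterQ RhW08.ClusterQM RhW08.NewtonDoor RhW08.NewtonDoorGenusOne RhW08.PurseP
open RhW08.AntiEscapeSplit7

/-! ## §9 PIECE R (ROOF LOCALISATION) modulo ONE typed analytic input — the SIGN IDENTITY (S1)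

(S1) says: the zeros of `F = f^{(j)}` other than `v, v̄` can be listed (with multiplicity, conjugation-closed) so that
`2·Im K_ext(v) = Σ_i pairTerm v (a i)`, i.e. `2ι = y·Σ_i pairTerm v (a i)`.  DERIVATION for C1 (no Hadamard constant, no limits):
put `g := F/((z − v)(z − v̄))` — REAL entire of the same growth, `g(v) = F′(v)/(v − v̄) ≠ 0`, `g′/g(v) = K − 1/(v − v̄) = K + i/(2y) = K_ext`,
`g′/g(v̄) = conj(K_ext)` (reality); the genus-one TWO-POINT identity (`…GenusOneLogDerivC3g41.logDeriv_sub_logDeriv_eq_tsum_zeros`, for the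
translate of `g`) between `v` and `v̄` gives `2i·Im K_ext = Σ_c [1/(v−c) − 1/(v̄−c)]`; re-indexing the conjugation-closed list,
`Σ_c Im 1/(v̄ − c) = −Σ_c Im 1/(v − c)`, whence `2·Im K_ext = Σ_c pairTerm v c`.  Below: GIVEN (S1), the cover criterion (R1) and the
quantitative localisation (R3) are PROVED, with the exact constant: `2ι·d₁ ≤ y·#(covering zeros listed)`, i.e. `ι·d₁ ≤ m·y` for `m` covering pairs. -/

/-- The PAIR TERM of the signed potential: `Im[(v − c)⁻¹ + (v − c̄)⁻¹]` (symmetric in `c ↔ c̄`). -/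
noncomputable def pairTerm (v c : ℂ) : ℝ := ((v - c)⁻¹ + (v - conj c)⁻¹).im

/-- Simp lemma: `pairTerm` is symmetric under conjugation of the second argument. -/
theorem pairTerm_conj (v c : ℂ) : pairTerm v (conj c) = pairTerm v c := by
  unfold pairTerm
  rw [Complex.conj_conj, add_comm]

/-- (S1) THE SIGN IDENTITY — typed analytic input (IDEA-NEEDED → C1; derivation in the section docstring). -/
def CoverIndexPairSum (f : ℂ → ℂ) (j : ℕ) (v : ℂ) : Prop :=
  ∃ (I : Type) (a : I → ℂ), (∀ i, iteratedDeriv j f (a i) = 0 ∧ a i ≠ v ∧ a i ≠ conj v) ∧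
    Summable (fun i => pairTerm v (a i)) ∧ 2 * coverIndex f j v = v.im * ∑' i, pairTerm v (a i)

/-- (R1) COVER CRITERION (given S1): a positive cover index forces a COVERING zero pair of `f^{(j)}`. -/
theorem exists_cover_of_coverIndex_pos {f : ℂ → ℂ} {j : ℕ} {v : ℂ} (hS : CoverIndexPairSum f j v) (hv : 0 < v.im)
    (hι : 0 < coverIndex f j v) :
    ∃ c : ℂ, iteratedDeriv j f c = 0 ∧ c ≠ v ∧ c ≠ conj v ∧ (v.re - c.re) ^ 2 + v.im ^ 2 < c.im ^ 2 := by
  obtain ⟨I, a, ha, hsum, hid⟩ := hS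
  by_contra hno
  push Not at hno
  have hle : ∀ i, pairTerm v (a i) ≤ 0 := by
    intro i
    obtain ⟨h0, h1, h2⟩ := ha i
    have hc := hno (a i) h0 h1 h2
    by_contra hp
    push Not at hp
    have := (pairField_im_pos_iff' hv h1 h2).mp hp
    linarith
  have h1 : ∑' i, pairTerm v (a i) ≤ 0 := tsum_nonpos hle
  have h2 : v.im * ∑' i, pairTerm v (a i) ≤ 0 := mul_nonpos_of_nonneg_of_nonpos hv.le h1
  linarith

/-- (R2) the pair term of an upper-half-plane zero is at most `1/‖v − c‖` (pure algebra: the `c̄`-part is negative and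
`(Im c − Im v)/‖v − c‖² ≤ 1/‖v − c‖`). -/
theorem pairTerm_le_inv_norm {v c : ℂ} (hv : 0 < v.im) (hc : 0 < c.im) (h1 : c ≠ v) :
    pairTerm v c ≤ 1 / ‖v - c‖ := by
  have hvc : v - c ≠ 0 := sub_ne_zero.mpr (Ne.symm h1)
  have hn1 : 0 < Complex.normSq (v - c) := Complex.normSq_pos.mpr hvc
  have hvc' : v - conj c ≠ 0 := by
    intro h
    have := congrArg Complex.im h
    simp at this
    linarith
  have hn2 : 0 < Complex.normSq (v - conj c) := Complex.normSq_pos.mpr hvc'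
  have hd : 0 < ‖v - c‖ := norm_pos_iff.mpr hvc
  unfold pairTerm
  rw [Complex.add_im, Complex.inv_im, Complex.inv_im]
  have him1 : (v - c).im = v.im - c.im := by simp
  have him2 : (v - conj c).im = v.im + c.im := by simp
  rw [him1, him2]
  have hA : -(v.im + c.im) / Complex.normSq (v - conj c) ≤ 0 :=
    div_nonpos_of_nonpos_of_nonneg (by linarith) hn2.le
  have hB : -(v.im - c.im) / Complex.normSq (v - c) ≤ 1 / ‖v - c‖ := by
    rw [Complex.normSq_eq_norm_sq, div_le_div_iff₀ (by positivity) hd]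
    have habs : |(v - c).im| ≤ ‖v - c‖ := Complex.abs_im_le_norm _
    rw [him1] at habs
    have : -(v.im - c.im) ≤ ‖v - c‖ := by
      have := neg_abs_le (v.im - c.im)
      have := abs_sub_comm v.im c.im
      linarith [le_abs_self (c.im - v.im)]
    nlinarith
  linarith

/-- (R3) ROOF LOCALISATION (given S1's list): if every covering listed zero lies in the finset `S` and each member of `S`
and its conjugate are at distance `≥ d₁` from `v`, then `2ι·d₁ ≤ y·#S` — a positive cover index puts a covering pair within
`#S·y/(2ι)` of `v` (`#S = 2m` for `m` covering pairs listed with both members). -/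
theorem coverIndex_mul_dist_le {f : ℂ → ℂ} {j : ℕ} {v : ℂ} (hv : 0 < v.im) {I : Type} {a : I → ℂ}
    (ha : ∀ i, iteratedDeriv j f (a i) = 0 ∧ a i ≠ v ∧ a i ≠ conj v)
    (hsum : Summable (fun i => pairTerm v (a i))) (hid : 2 * coverIndex f j v = v.im * ∑' i, pairTerm v (a i))
    (S : Finset I) (hcov : ∀ i, (v.re - (a i).re) ^ 2 + v.im ^ 2 < (a i).im ^ 2 → i ∈ S)
    {d₁ : ℝ} (hd₁ : 0 < d₁) (hd : ∀ i ∈ S, d₁ ≤ ‖v - a i‖ ∧ d₁ ≤ ‖v - conj (a i)‖) :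
    2 * coverIndex f j v * d₁ ≤ v.im * S.card := by
  classical
  -- termwise majorant supported on S
  set g : I → ℝ := fun i => if i ∈ S then 1 / d₁ else 0 with hg
  have hPg : ∀ i, pairTerm v (a i) ≤ g i := by
    intro i
    obtain ⟨h0, h1, h2⟩ := ha i
    by_cases hi : i ∈ S
    · simp only [hg, hi, if_true]
      obtain ⟨hda, hdb⟩ := hd i hi
      -- use the upper representative
      rcases lt_trichotomy 0 (a i).im with hpos | hzero | hneg
      · calc pairTerm v (a i) ≤ 1 / ‖v - a i‖ := pairTerm_le_inv_norm hv hpos h1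
          _ ≤ 1 / d₁ := one_div_le_one_div_of_le hd₁ hda
      · -- real zero: pair term ≤ 0
        have hnp : ¬ 0 < pairTerm v (a i) := by
          intro hp
          have := (pairField_im_pos_iff' hv h1 h2).mp hp
          rw [← hzero] at this
          nlinarith [sq_nonneg (v.re - (a i).re)]
        push Not at hnp
        exact hnp.trans (by positivity)
      · have hpos' : 0 < (conj (a i)).im := by simp; linarith
        have h1' : conj (a i) ≠ v := by
          intro h; apply h2; rw [← h, Complex.conj_conj]
        calc pairTerm v (a i) = pairTerm v (conj (a i)) := (pairTerm_conj v (a i)).symm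
          _ ≤ 1 / ‖v - conj (a i)‖ := pairTerm_le_inv_norm hv hpos' h1'
          _ ≤ 1 / d₁ := one_div_le_one_div_of_le hd₁ hdb
    · simp only [hg, hi, if_false]
      have hnc : ¬ ((v.re - (a i).re) ^ 2 + v.im ^ 2 < (a i).im ^ 2) := fun h => hi (hcov i h)
      by_contra hp
      push Not at hp
      exact hnc ((pairField_im_pos_iff' hv h1 h2).mp hp)
  have hgS : ∀ i ∉ S, g i = 0 := by intro i hi; simp [hg, hi]
  have hgsum : Summable g := summable_of_ne_finset_zero hgS
  have h1 : ∑' i, pairTerm v (a i) ≤ ∑' i, g i := hsum.tsum_le_tsum hPg hgsum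
  have h2 : ∑' i, g i = S.card * (1 / d₁) := by
    rw [tsum_eq_sum (s := S) (fun i hi => hgS i hi)]
    have : ∀ i ∈ S, g i = 1 / d₁ := by intro i hi; simp [hg, hi]
    rw [Finset.sum_congr rfl this, Finset.sum_const, nsmul_eq_mul]
  have h3 : 2 * coverIndex f j v ≤ v.im * (S.card * (1 / d₁)) := by
    rw [hid, ← h2]; exact mul_le_mul_of_nonneg_left h1 hv.le
  have h4 : v.im * (S.card * (1 / d₁)) * d₁ = v.im * S.card := by field_simp
  calc 2 * coverIndex f j v * d₁ ≤ v.im * (S.card * (1 / d₁)) * d₁ := mul_le_mul_of_nonneg_right h3 hd₁.le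
    _ = v.im * S.card := h4

/-! ## §10 (S1) PROVED — the SIGN IDENTITY, hence PIECE R UNCONDITIONAL in the frame

`coverIndexPairSum_of_growth`: for `F = f^{(j)}` real entire of genus-one growth and a simple zero `v` with `Im v > 0`,
`CoverIndexPairSum f j v` holds — the zero list is Hadamard's (`hadamard_genus_one_zeros`) for the translate of the REAL entire
second cofactor `g = dslope (dslope F v) v̄`, the identity is the genus-one two-point formula
(`GenusOneLogDerivC3g41.logDeriv_sub_logDeriv_eq_tsum_zeros`) between `v̄` and `v` (`g′/g(v) = K − 1/(v − v̄) = K + i/(2y)`,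
`g′/g(v̄) = conj` by Schwarz reflection), and `Im[1/(v̄ − c) − 1/(v − c)] = −pairTerm v c` termwise (no re-indexing, no Hadamard
constant, no limits).  Frame corollaries: `coverIndexPairSum_of_frame` (from `EngineHyps5` + a band state + `f^{(j+1)}(v) ≠ 0`),
`exists_cover_of_coverIndex_pos_frame` (ι > 0 ⇒ a COVERING pair of zeros of `f^{(j)}` exists), `exists_cover_of_weak_frame`
(κ < ½ ⇒ covered) and `roof_localisation_frame` (`2ι·d₁ ≤ y·#S`). -/

/-- (L1) the two-point term between `v̄` and `v` has imaginary part `−pairTerm`. -/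
theorem im_twoPoint_term (v c : ℂ) : ((conj v - c)⁻¹ - (v - c)⁻¹).im = - pairTerm v c := by
  have h : (conj v - c)⁻¹ = conj ((v - conj c)⁻¹) := by
    rw [map_inv₀, map_sub, Complex.conj_conj]
  unfold pairTerm
  rw [h, Complex.sub_im, Complex.conj_im, Complex.add_im]
  ring

/-- (L2) a real entire function has conjugate-symmetric derivative. -/
theorem deriv_conj_of_real {g : ℂ → ℂ} (hg : Differentiable ℂ g) (hreal : ∀ z, g (conj z) = conj (g z))
    (z : ℂ) : deriv g (conj z) = conj (deriv g z) := by
  have h1 : HasDerivAt g (deriv g z) z := (hg z).hasDerivAt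
  have h2 := h1.conj_conj
  have hfun : (conj ∘ g ∘ conj : ℂ → ℂ) = g := by
    funext x
    simp only [Function.comp_apply]
    rw [hreal, Complex.conj_conj]
  rw [hfun] at h2
  exact h2.deriv

open Filter Topology in
/-- (L3) logarithmic derivative of `dslope h w` at a point `v ≠ w` where `h w = 0`, `h v ≠ 0`. -/
theorem logDeriv_dslope_of_ne {h : ℂ → ℂ} (hh : Differentiable ℂ h) {v w : ℂ} (hvw : v ≠ w) (hhw : h w = 0)
    (hhv : h v ≠ 0) : deriv (dslope h w) v / dslope h w v = deriv h v / h v - 1 / (v - w) := by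
  have hval : ∀ z, z ≠ w → dslope h w z = h z * (z - w)⁻¹ := by
    intro z hz
    rw [dslope_of_ne _ hz, slope_def_field, hhw, sub_zero, div_eq_mul_inv]
  have hev : dslope h w =ᶠ[𝓝 v] fun z => h z * (z - w)⁻¹ := by
    filter_upwards [isOpen_ne.mem_nhds hvw] with z hz
    exact hval z hz
  have hsub : v - w ≠ 0 := sub_ne_zero.2 hvw
  have hd1 : HasDerivAt h (deriv h v) v := (hh v).hasDerivAt
  have hd2 : HasDerivAt (fun z : ℂ => (z - w)⁻¹) (-(1 : ℂ) / (v - w) ^ 2) v := by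
    have := ((hasDerivAt_id v).sub_const w).fun_inv (by simpa using hsub)
    simpa using this
  have hd : HasDerivAt (fun z => h z * (z - w)⁻¹) (deriv h v * (v - w)⁻¹ + h v * (-(1 : ℂ) / (v - w) ^ 2)) v :=
    hd1.mul hd2
  have hderiv : deriv (dslope h w) v = deriv h v * (v - w)⁻¹ + h v * (-(1 : ℂ) / (v - w) ^ 2) :=
    (hd.congr_of_eventuallyEq hev).deriv
  rw [hderiv, hval v hvw]
  field_simp
  ring

/-- (S1) PROVED: the sign identity for `F = f^{(j)}` real entire of genus-one growth at a simple zero `v` in the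
upper half-plane.  The zero list is Hadamard's for the translate of `g = dslope (dslope F v) v̄`. -/
theorem coverIndexPairSum_of_growth {f : ℂ → ℂ} {j : ℕ} {v : ℂ} {C ρ : ℝ}
    (hF : Differentiable ℂ (iteratedDeriv j f))
    (hgrowth : ∀ z, ‖iteratedDeriv j f z‖ ≤ C * Real.exp (‖z‖ ^ ρ)) (hρ : ρ < 2)
    (hreal : ∀ z, iteratedDeriv j f (conj z) = conj (iteratedDeriv j f z))
    (hv : 0 < v.im) (hFv : iteratedDeriv j f v = 0)
    (hsimple : analyticOrderAt (iteratedDeriv j f) v = 1) :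
    CoverIndexPairSum f j v := by
  set F : ℂ → ℂ := iteratedDeriv j f with hFdef
  set w : ℂ := conj v with hwdef
  have hwv : w ≠ v := by
    intro e
    have := congrArg Complex.im e
    rw [hwdef, Complex.conj_im] at this
    linarith
  have hvw : v ≠ w := fun e => hwv e.symm
  -- first cofactor
  set h : ℂ → ℂ := dslope F v with hhdef
  have hhd : Differentiable ℂ h := Literature.NumberTheory.LFunctions.BurnolVectors.differentiable_dslope hF v
  have hhv : h v ≠ 0 := by
    rw [hhdef, dslope_same]
    exact Literature.Barriers.RiemannHypothesis.deriv_ne_zero_of_analyticOrderAt_eq_one (hF.analyticAt v) hsimple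
  have hval : ∀ z, z ≠ v → h z = F z / (z - v) := by
    intro z hz
    rw [hhdef, dslope_of_ne _ hz, slope_def_field, hFv, sub_zero]
  have hFw : F w = 0 := by
    rw [hwdef, hreal v, hFv, map_zero]
  have hhw : h w = 0 := by rw [hval w hwv, hFw, zero_div]
  -- second cofactor
  set g : ℂ → ℂ := dslope h w with hgdef
  have hgd : Differentiable ℂ g := Literature.NumberTheory.LFunctions.BurnolVectors.differentiable_dslope hhd w
  have hgval : ∀ z, z ≠ w → g z = h z / (z - w) := by
    intro z hz
    rw [hgdef, dslope_of_ne _ hz, slope_def_field, hhw, sub_zero]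
  have hgval2 : ∀ z, z ≠ v → z ≠ w → g z = F z / ((z - v) * (z - w)) := by
    intro z h1 h2
    rw [hgval z h2, hval z h1, div_div]
  have hgv : g v ≠ 0 := by
    rw [hgval v hvw]
    exact div_ne_zero hhv (sub_ne_zero.2 hvw)
  -- reality of g (continuity + density off {v, w})
  have hgreal : ∀ z, g (conj z) = conj (g z) := by
    have hc1 : Continuous fun z => g (conj z) := hgd.continuous.comp Complex.continuous_conj
    have hc2 : Continuous fun z => conj (g z) := Complex.continuous_conj.comp hgd.continuous
    have hfin : ({v, w} : Set ℂ).Finite := (Set.finite_singleton w).insert v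
    have hdense : Dense (Set.univ \ {v, w} : Set ℂ) := dense_univ.sdiff_finite hfin
    have heq : Set.EqOn (fun z => g (conj z)) (fun z => conj (g z)) (Set.univ \ {v, w}) := by
      intro z hz
      simp only [Set.mem_sdiff, Set.mem_univ, true_and, Set.mem_insert_iff, Set.mem_singleton_iff, not_or] at hz
      obtain ⟨hzv, hzw⟩ := hz
      have h1 : conj z ≠ v := by
        intro e; apply hzw; rw [hwdef, ← e, Complex.conj_conj]
      have h2 : conj z ≠ w := by
        intro e; apply hzv
        have := congrArg conj e
        rw [Complex.conj_conj, hwdef, Complex.conj_conj] at this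
        exact this
      show g (conj z) = conj (g z)
      rw [hgval2 (conj z) h1 h2, hgval2 z hzv hzw, hreal z, map_div₀, map_mul, map_sub, map_sub, hwdef,
        Complex.conj_conj]
      ring
    intro z
    exact congrFun (Continuous.ext_on hdense hc1 hc2 heq) z
  have hgw : g w ≠ 0 := by
    intro h0
    apply hgv
    have h1 : conj (g v) = 0 := by rw [← hgreal v, ← hwdef, h0]
    simpa using congrArg conj h1
  -- growth and Hadamard for the translate
  obtain ⟨C₁, hC₁, hg₁⟩ := GenusOneLogDerivC3g41.growth_nonneg_exponent hF hgrowth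
  set σ : ℝ := max ρ 0 with hσ
  have hσ0 : 0 ≤ σ := le_max_right _ _
  have hσ2 : σ < 2 := max_lt hρ (by norm_num)
  have hgh : ∀ z, ‖h z‖ ≤ (C₁ * Real.exp ((‖v‖ + 1) ^ σ)) * Real.exp (‖z‖ ^ σ) :=
    fun z => GenusOneLogDerivC3g41.norm_dslope_le hF hσ0 hg₁ hFv z
  have hgg : ∀ z, ‖g z‖ ≤ ((C₁ * Real.exp ((‖v‖ + 1) ^ σ)) * Real.exp ((‖w‖ + 1) ^ σ)) * Real.exp (‖z‖ ^ σ) :=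
    fun z => GenusOneLogDerivC3g41.norm_dslope_le hhd hσ0 hgh hhw z
  set G : ℂ → ℂ := fun x => g (x + v) with hGdef
  have hGd : Differentiable ℂ G := hgd.comp (differentiable_id.add_const v)
  set σ' : ℝ := (σ + 2) / 2 with hσ'
  have hσσ' : σ < σ' := by rw [hσ']; linarith
  have hσ'2 : σ' < 2 := by rw [hσ']; linarith
  obtain ⟨C₂, hg₂⟩ := GenusOneLogDerivC3g41.growth_translate hσ0 (by positivity) hgg v hσσ'
  have hG0 : G 0 ≠ 0 := by simpa [hGdef] using hgv
  have hGx : G (w - v) ≠ 0 := by simpa [hGdef] using hgw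
  obtain ⟨b, hb, hzero, -, hprod⟩ := hadamard_genus_one_zeros G σ' C₂ hGd hσ'2 hg₂ hG0
  obtain ⟨hsumZ, hidZ⟩ :=
    GenusOneLogDerivC3g41.logDeriv_sub_logDeriv_eq_tsum_zeros hG0 hb hprod hGx hG0 (hGd _) (hGd _)
  have hlogG : ∀ x : ℂ, logDeriv G x = deriv g (x + v) / g (x + v) := by
    intro x
    rw [logDeriv_apply, hGdef]
    simp only [deriv_comp_add_const]
  rw [hlogG, hlogG, sub_add_cancel, zero_add] at hidZ
  set L : ℂ := deriv g v / g v with hL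
  have hLv : L = newtonK f j v - 1 / (v - w) := by
    rw [hL, hgdef, logDeriv_dslope_of_ne hhd hvw hhw hhv]
    rfl
  have hLw : deriv g w / g w = conj L := by
    rw [hL, map_div₀, ← deriv_conj_of_real hgd hgreal v, ← hgreal v]
  rw [hLw] at hidZ
  -- imaginary parts
  have him := congrArg Complex.im hidZ
  rw [Complex.sub_im, Complex.conj_im, Complex.im_tsum hsumZ] at him
  have hterm : ∀ n, (((GenusOneLogDerivC3g41.mult b n : ℝ) : ℂ) *
      (1 / (w - v - (b n)⁻¹) - 1 / (0 - (b n)⁻¹))).im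
      = -(GenusOneLogDerivC3g41.mult b n * pairTerm v (v + (b n)⁻¹)) := by
    intro n
    rw [Complex.im_ofReal_mul]
    have e1 : w - v - (b n)⁻¹ = conj v - (v + (b n)⁻¹) := by rw [hwdef]; ring
    have e2 : (0 : ℂ) - (b n)⁻¹ = v - (v + (b n)⁻¹) := by ring
    rw [e1, e2, one_div, one_div, im_twoPoint_term]
    ring
  simp only [hterm] at him
  rw [tsum_neg] at him
  have hsumR : Summable (fun n => GenusOneLogDerivC3g41.mult b n * pairTerm v (v + (b n)⁻¹)) := by
    have h1 := (Complex.hasSum_im hsumZ.hasSum).summable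
    simp only [hterm] at h1
    simpa using h1.neg
  -- Im L = Im K + 1/(2y)
  have hLim : L.im = (newtonK f j v).im + 1 / (2 * v.im) := by
    rw [hLv, Complex.sub_im, hwdef]
    have him' : (v - conj v).im = 2 * v.im := by simp [two_mul]
    have hre' : (v - conj v).re = 0 := by simp
    have hns : Complex.normSq (v - conj v) = (2 * v.im) ^ 2 := by
      rw [Complex.normSq_apply, hre', him']; ring
    rw [one_div, Complex.inv_im, him', hns]
    have hy : v.im ≠ 0 := hv.ne'
    field_simp
    ring
  have hmainN : 2 * coverIndex f j v =
      v.im * ∑' n, GenusOneLogDerivC3g41.mult b n * pairTerm v (v + (b n)⁻¹) := by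
    have h2 : 2 * L.im = ∑' n, GenusOneLogDerivC3g41.mult b n * pairTerm v (v + (b n)⁻¹) := by linarith
    unfold coverIndex
    have hy : v.im ≠ 0 := hv.ne'
    rw [← h2, hLim]
    field_simp
  -- restrict to the genuine zeros
  have hmult1 : ∀ i : {n : ℕ // b n ≠ 0}, GenusOneLogDerivC3g41.mult b i.1 = 1 := fun i => by
    simp [GenusOneLogDerivC3g41.mult, i.2]
  have hsupp : Function.support (fun n => GenusOneLogDerivC3g41.mult b n * pairTerm v (v + (b n)⁻¹)) ⊆
      {n : ℕ | b n ≠ 0} := by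
    intro n hn
    simp only [Function.mem_support, ne_eq] at hn
    intro hb0
    apply hn
    simp [GenusOneLogDerivC3g41.mult, hb0]
  have htsum : ∑' n, GenusOneLogDerivC3g41.mult b n * pairTerm v (v + (b n)⁻¹) =
      ∑' i : {n : ℕ // b n ≠ 0}, pairTerm v (v + (b i.1)⁻¹) := by
    rw [← tsum_subtype_eq_of_support_subset hsupp]
    exact tsum_congr fun i => by rw [hmult1 i, one_mul]
  have hsumI : Summable (fun i : {n : ℕ // b n ≠ 0} => pairTerm v (v + (b i.1)⁻¹)) := by
    have h1 := hsumR.subtype {n : ℕ | b n ≠ 0}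
    refine h1.congr fun i => ?_
    simp only [Function.comp_apply]
    rw [hmult1 i, one_mul]
  refine ⟨{n : ℕ // b n ≠ 0}, fun i => v + (b i.1)⁻¹, fun i => ?_, hsumI, ?_⟩
  · have hbi : b i.1 ≠ 0 := i.2
    have hci_v : v + (b i.1)⁻¹ ≠ v := by
      intro e
      apply hbi
      have : (b i.1)⁻¹ = 0 := by simpa using e
      exact inv_eq_zero.1 this
    have hGi : g (v + (b i.1)⁻¹) = 0 := by
      have := hzero i.1 hbi
      simpa [hGdef, add_comm] using this
    have hci_w : v + (b i.1)⁻¹ ≠ w := by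
      intro e
      rw [e] at hGi
      exact hgw hGi
    refine ⟨?_, hci_v, by rw [← hwdef]; exact hci_w⟩
    have hq := hgval2 _ hci_v hci_w
    rw [hGi] at hq
    have hden : (v + (b i.1)⁻¹ - v) * (v + (b i.1)⁻¹ - w) ≠ 0 :=
      mul_ne_zero (sub_ne_zero.2 hci_v) (sub_ne_zero.2 hci_w)
    exact (div_eq_zero_iff.1 hq.symm).resolve_right hden
  · rw [hmainN, htsum]


end RhW08.Lens1Coverage
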